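import Literature.MathematicalPhysics.QuantumFieldTheory.Balaban1983to89.B9Eq326LocalPartKatoForm
import Literature.MathematicalPhysics.QuantumFieldTheory.Balaban1983to89.B9Eq347LocalLetterAdjoint

/-!
# `Balaban1983to89.B9Eq326LocalPartGradientRowAdjoint` — T. Bałaban, *Propagators for lattice gauge theories in a background field*, Commun. Math. Phys.
# **99** (1985) 389–434 [Balaban1985BackgroundPropagators] Thm 3.1 (3.42) p. 397 (second entry, the covariant-gradient row), (3.26) p. 395 (the local part
# `A₀ = Δ(U) + D_UD*_U + Q*aQ`), (3.8) p. 392 («D* is the adjoint of D»), p. 391 *«The adjoints are taken with respect to natural L² scalar products»*,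
# (3.49) p. 399: **THE TRANSPOSED ROW — the (L) letter of `A₀⁻¹D_U` (sites → bonds) FROM the (L) letter of `D*_U A₀⁻¹` (bonds → sites) by `L²` duality:
# `A₀` is symmetric (`Δ(U)` symmetric — `B9Eq310HessianHermitian.hessOp_isSymmetric` —, `D_U∘D*_U = D_U∘D_U†`, `Q†(a•Q)` with `a` real), so
# `(A₀⁻¹)† = A₀⁻¹` and `(D*_U∘A₀⁻¹)† = A₀⁻¹∘D_U` (`B11Eq103H1Complex.adjoint_covDerivL2K`); ne9-leaf-03's `B9Eq347LocalLetterAdjoint.local_adjoint` then turns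
# (L)(`D*_UA₀⁻¹`; B, κ) into (L)(`A₀⁻¹D_U`; B·L^d, κ) on the one-step torus (bond weights = site weights = `c₀`; a site block weighs `c₀·L^d`)** — the
# OWNER's plan v11 §2 (ii), second half, GENERIC in the letter of the first half (this lineage's (K57) `B9Eq326LocalPartDivergenceBlockLetterClosed` inhabits
# `hloc`; the junction is the consumer's one-liner) (successor memo `t4/b2b-balaban-t4-ne9-formalise-leaf-05/g85/STOREY-J-A0-MAP-g85.md` §3 (c))

statement-level skeleton of published theorems with citation tags; proofs where landed; nothing here is a claim about the Yang–Mills mass gap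

CITATION HEADER (lean-in-tree rule).  Audit cell `pub-balaban`, sub-cell `t4`, BINDER row NE9; filed by NE9 crux-team LEAF PROVER 05
(`b2b-balaban-t4-ne9-formalise-leaf-05`, gen 86).  Imports the NE9 OWNER's `B9Eq326LocalPartKatoForm` (for `B9Eq310HessianOperator.hessOp` and the `A₀`
shape; through it `B11Eq103H1Complex.greenK` ∕ `adjoint_covDerivL2K`) and ne9-leaf-03's `B9Eq347LocalLetterAdjoint` (`local_adjoint`; through it
`B9Eq349BlockDecayFromKernel.card_sites_block_le`).  SOURCE READ first-hand in the held text layer [Balaban1985BackgroundPropagators]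
(`paper:balaban1985-cmp99-background-propagators`): p. 397 Thm 3.1 (3.42); p. 395 (3.26); p. 392 (3.8); p. 391 (the sentence on adjoints); p. 399 (3.49).
[folklore] `L²` duality BY NAME; nothing printed is a hypothesis; the `[cite: …]` tags are TEXT LOCATIONS.

WHAT IS PROVED (sorry-free; 0 `def`; [folklore]).
* §1 **`adjoint_greenK_of_isSymmetric`** — on a finite-dimensional Hilbert space: `T` symmetric with `0 < re⟨x,Tx⟩` (`x ≠ 0`) ⟹ `(greenK T)† = greenK T`.
* §2 **`adjoint_covDivL2K`** (`(D*_U)† = D_U`), **`localPart_isSymmetric`** — `A₀ = hessOp + D_U∘D*_U + Q†∘(a•Q)` (`Q` any linear map to a finite-dimensional Hilbert space, `a` real) is symmetric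
  given `hessOp` symmetric and mutually adjoint transporters (`hRS`); **`adjoint_covDivL2K_comp_greenK`** — `(D*_U ∘ A₀⁻¹)† = A₀⁻¹ ∘ D_U` as linear maps.
* §3 **`transposed_blockLetter`** — on the fine torus `T_{(L·m)}` (bond and site carriers of weight `c₀`, blocks of `blockCoord`, self-adjoint block families
  `PB` (bonds) ∕ `PS` (sites) given pointwise): IF `D*_U A₀⁻¹` has the (L) letter `‖(D*_U A₀⁻¹ f)(y)‖ ≤ B·e^{−κ·d_m(B(y), v)}·F` for `f` supported over the
  bonds of `B(v)` with `sup ≤ F`, THEN for `g` supported over the sites of `B(u)` with `sup ≤ G` and every bond `b`: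
  `‖(A₀⁻¹ D_U g)(b)‖ ≤ B·L^d·e^{−κ·d_m(B(b₋), u)}·G`.
HONEST SCOPE.  Duality and naming only; the letter `B, κ` of `D*_UA₀⁻¹` is DISPLAYED (supplier: (K57)); the symmetry of `hessOp` is DISPLAYED (supplier:
`B9Eq310HessianHermitian.hessOp_isSymmetric(_of_trace)` from `τ(X*) = conj τ(X)`, `τ(XY) = τ(YX)`, unitary `U`); the self-adjointness of the block families is
DISPLAYED (supplier: ne9-leaf-01's `B9Eq349KWAssembly.adjoint_eq_self_of_pointwise`); the price `L^d` is the honest one-step price of the abstract duality road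
(`B9Eq347LocalLetterAdjoint` HONEST SCOPE) — a direct storey-J run on `A₀⁻¹D_U` would avoid it; nothing of [B9] Thm 3.1∕3.3∕3.11 is asserted, valued or
discharged.  NOT NE9 (cell pub-balaban: NE9 NOT PRINTED ∕ NOT PROVED; «NE9 ⇐ the named binders»; row WALLED ON A MODEL (O-NE9-1; #5 UNRULED); spine PROVED
0∕9; rung (B)+1 on a finite T⁴ — NOT infinite volume, NOT mass gap, NOT Clay; HONEST DEPENDENCY: continuum YM on T⁴ ⇐ BetaPertH ∧ nine spine estimates
(0/9 proved); BetaPertH ⇐ (D1) ∧ (D4) ∧ CAP+tail; G-an2-4 gates asym, D1 and NE2/3/4).  NEW file; nothing modified.  Net new unproved facts: 0.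
-/

noncomputable section

set_option autoImplicit false

open scoped InnerProductSpace ComplexConjugate BigOperators

namespace Literature.MathematicalPhysics.QuantumFieldTheory.Balaban1983to89.B9Eq326LocalPartGradientRowAdjoint

open B4Sect5Torus (TSite tdist tdist_symm)
open B9SectCLatticeCarrier (Bond bpos)
open B9Eq311L2Pairing (WL2)
open B9Eq319QprimeTorus (fineP blockCoord)
open B11Eq103H1Complex (SiteL2K BondL2K greenK apply_greenK covDerivL2K covDivL2K adjoint_covDerivL2K)
open B9Eq310HessianOperator (adTransportW hessOp)
open B9Eq347LocalLetterAdjoint (local_adjoint)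
open B9Eq349BlockDecayFromKernel (card_sites_block_le)

/-! ## §1 The inverse of a symmetric operator is self-adjoint -/

section Green

variable {𝕜 : Type*} [RCLike 𝕜] {E : Type*} [NormedAddCommGroup E] [InnerProductSpace 𝕜 E] [FiniteDimensional 𝕜 E]

/-- **`(T⁻¹)† = T⁻¹` FOR SYMMETRIC `T`**: if `T` is symmetric and `0 < re⟨x, Tx⟩` for `x ≠ 0`, then `(greenK T)† = greenK T`
(`⟨T⁻¹x, y⟩ = ⟨T⁻¹x, T(T⁻¹y)⟩ = ⟨T(T⁻¹x), T⁻¹y⟩ = ⟨x, T⁻¹y⟩`). [folklore] [cite: Balaban1985BackgroundPropagators, p.391 «The adjoints are taken with respect to natural L² scalar products»] -/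
theorem adjoint_greenK_of_isSymmetric (T : E →ₗ[𝕜] E) (hT : T.IsSymmetric) (hpos : ∀ x : E, x ≠ 0 → 0 < RCLike.re ⟪x, T x⟫_𝕜) :
    LinearMap.adjoint (greenK T hpos) = greenK T hpos := by
  refine ((LinearMap.eq_adjoint_iff (greenK T hpos) (greenK T hpos)).2 fun x y => ?_).symm
  conv_lhs => rw [← apply_greenK hpos y]
  rw [← hT (greenK T hpos x) (greenK T hpos y), apply_greenK]

end Green

/-! ## §2 `A₀` is symmetric; `(D*_U∘A₀⁻¹)† = A₀⁻¹∘D_U` -/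

section LocalPart

variable {d : ℕ} {Pd : Fin d → ℕ} {𝔸 : Type*} [Ring 𝔸] [StarRing 𝔸] [Algebra ℂ 𝔸] [StarModule ℂ 𝔸]
  {W : Type*} [NormedAddCommGroup W] [InnerProductSpace ℂ W] [FiniteDimensional ℂ W] (φ : W ≃ₗ[ℂ] 𝔸) {c₀ : ℝ} [Fact (0 < c₀)]
  (τ : 𝔸 →ₗ[ℂ] ℂ) (η : ℝ) (U : Bond d Pd → 𝔸ˣ)
  (hRS : ∀ (b : Bond d Pd) (v u : W), ⟪adTransportW φ U b v, u⟫_ℂ = ⟪v, adTransportW φ (fun b => (U b)⁻¹) b u⟫_ℂ)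
  (hH : (hessOp (c₀ := c₀) φ η U τ).IsSymmetric)
  {F : Type*} [NormedAddCommGroup F] [InnerProductSpace ℂ F] [FiniteDimensional ℂ F] (Q : BondL2K ℂ d Pd c₀ W →ₗ[ℂ] F) (a : ℝ)
  (A₀ : BondL2K ℂ d Pd c₀ W →ₗ[ℂ] BondL2K ℂ d Pd c₀ W)
  (hA₀ : A₀ = hessOp φ η U τ + covDerivL2K ℂ c₀ ((η : ℂ))⁻¹ (adTransportW φ U) ∘ₗ covDivL2K ℂ c₀ ((η : ℂ))⁻¹ (adTransportW φ fun b => (U b)⁻¹) +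
    LinearMap.adjoint Q ∘ₗ ((a : ℂ) • Q))

omit [StarRing 𝔸] [StarModule ℂ 𝔸] in
include hRS in
/-- **`D*_U = D_U†` and `D_U = (D*_U)†`** at the scalar `η⁻¹` (`B11Eq103H1Complex.adjoint_covDerivL2K` and `adjoint_adjoint`). [cite: Balaban1985BackgroundPropagators, (3.8) p.392] -/
theorem adjoint_covDivL2K :
    LinearMap.adjoint (covDivL2K ℂ c₀ ((η : ℂ))⁻¹ (adTransportW φ fun b => (U b)⁻¹)) = covDerivL2K ℂ c₀ ((η : ℂ))⁻¹ (adTransportW φ U) := by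
  rw [← adjoint_covDerivL2K ((η : ℂ))⁻¹ (by rw [map_inv₀, Complex.conj_ofReal]) _ _ hRS, LinearMap.adjoint_adjoint]

include hRS hH hA₀ in
/-- **`A₀` IS SYMMETRIC**: `⟨A₀x, y⟩ = ⟨x, A₀y⟩` — `hessOp` symmetric, `⟨D_U(D*_Ux), y⟩ = ⟨D*_Ux, D*_Uy⟩` (`D*_U = D_U†`), `⟨Q†(a•Qx), y⟩ = a⟨Qx, Qy⟩` (`a` real).
[folklore] [cite: Balaban1985BackgroundPropagators, (3.26) p.395, (3.8) p.392, p.391] -/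
theorem localPart_isSymmetric : A₀.IsSymmetric := by
  have hD : covDivL2K ℂ c₀ ((η : ℂ))⁻¹ (adTransportW φ fun b => (U b)⁻¹) = LinearMap.adjoint (covDerivL2K ℂ c₀ ((η : ℂ))⁻¹ (adTransportW φ U)) :=
    (adjoint_covDerivL2K ((η : ℂ))⁻¹ (by rw [map_inv₀, Complex.conj_ofReal]) _ _ hRS).symm
  intro x y
  rw [hA₀, hD]
  simp only [LinearMap.add_apply, LinearMap.comp_apply, LinearMap.smul_apply, inner_add_left, inner_add_right]
  have h1 : ⟪hessOp (c₀ := c₀) φ η U τ x, y⟫_ℂ = ⟪x, hessOp (c₀ := c₀) φ η U τ y⟫_ℂ := hH x y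
  have h2 : ⟪covDerivL2K ℂ c₀ ((η : ℂ))⁻¹ (adTransportW φ U) (LinearMap.adjoint (covDerivL2K ℂ c₀ ((η : ℂ))⁻¹ (adTransportW φ U)) x), y⟫_ℂ =
      ⟪x, covDerivL2K ℂ c₀ ((η : ℂ))⁻¹ (adTransportW φ U) (LinearMap.adjoint (covDerivL2K ℂ c₀ ((η : ℂ))⁻¹ (adTransportW φ U)) y)⟫_ℂ := by
    rw [← LinearMap.adjoint_inner_right (covDerivL2K ℂ c₀ ((η : ℂ))⁻¹ (adTransportW φ U))
        (LinearMap.adjoint (covDerivL2K ℂ c₀ ((η : ℂ))⁻¹ (adTransportW φ U)) x) y,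
      ← LinearMap.adjoint_inner_left (covDerivL2K ℂ c₀ ((η : ℂ))⁻¹ (adTransportW φ U))
        (LinearMap.adjoint (covDerivL2K ℂ c₀ ((η : ℂ))⁻¹ (adTransportW φ U)) y) x]
  have h3 : ⟪LinearMap.adjoint Q ((a : ℂ) • Q x), y⟫_ℂ = ⟪x, LinearMap.adjoint Q ((a : ℂ) • Q y)⟫_ℂ := by
    rw [LinearMap.adjoint_inner_left, LinearMap.adjoint_inner_right, inner_smul_left, inner_smul_right, Complex.conj_ofReal]
  rw [h1, h2, h3]

include hRS hH hA₀ in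
/-- **`(D*_U ∘ A₀⁻¹)† = A₀⁻¹ ∘ D_U`** (`(A₀⁻¹)† = A₀⁻¹` by §1 and §2, `(D*_U)† = D_U`). [folklore] [cite: Balaban1985BackgroundPropagators, (3.26) p.395, (3.8) p.392, p.391] -/
theorem adjoint_covDivL2K_comp_greenK (hpos₀ : ∀ x : BondL2K ℂ d Pd c₀ W, x ≠ 0 → 0 < RCLike.re ⟪x, A₀ x⟫_ℂ) :
    LinearMap.adjoint (covDivL2K ℂ c₀ ((η : ℂ))⁻¹ (adTransportW φ fun b => (U b)⁻¹) ∘ₗ greenK A₀ hpos₀) =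
      greenK A₀ hpos₀ ∘ₗ covDerivL2K ℂ c₀ ((η : ℂ))⁻¹ (adTransportW φ U) := by
  rw [LinearMap.adjoint_comp, adjoint_covDivL2K φ η U hRS,
    adjoint_greenK_of_isSymmetric A₀ (localPart_isSymmetric φ τ η U hRS hH Q a A₀ hA₀) hpos₀]

end LocalPart

/-! ## §3 The transposed (L) letter on the one-step torus -/

section Transposed

variable {d : ℕ} (L : ℕ) [NeZero L] (m : Fin d → ℕ) (hm : ∀ i, 1 ≤ m i)
  {𝔸 : Type*} [Ring 𝔸] [StarRing 𝔸] [Algebra ℂ 𝔸] [StarModule ℂ 𝔸]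
  {W : Type*} [NormedAddCommGroup W] [InnerProductSpace ℂ W] [FiniteDimensional ℂ W] (φ : W ≃ₗ[ℂ] 𝔸) {c₀ : ℝ} [Fact (0 < c₀)]
  (τ : 𝔸 →ₗ[ℂ] ℂ) (η : ℝ) (U : Bond d (fineP L m) → 𝔸ˣ)
  (hRS : ∀ (b : Bond d (fineP L m)) (v u : W), ⟪adTransportW φ U b v, u⟫_ℂ = ⟪v, adTransportW φ (fun b => (U b)⁻¹) b u⟫_ℂ)
  (hH : (hessOp (c₀ := c₀) φ η U τ).IsSymmetric)
  {F : Type*} [NormedAddCommGroup F] [InnerProductSpace ℂ F] [FiniteDimensional ℂ F] (Q : BondL2K ℂ d (fineP L m) c₀ W →ₗ[ℂ] F) (a : ℝ)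
  (A₀ : BondL2K ℂ d (fineP L m) c₀ W →ₗ[ℂ] BondL2K ℂ d (fineP L m) c₀ W)
  (hA₀ : A₀ = hessOp φ η U τ + covDerivL2K ℂ c₀ ((η : ℂ))⁻¹ (adTransportW φ U) ∘ₗ covDivL2K ℂ c₀ ((η : ℂ))⁻¹ (adTransportW φ fun b => (U b)⁻¹) +
    LinearMap.adjoint Q ∘ₗ ((a : ℂ) • Q))
  (hpos₀ : ∀ x : BondL2K ℂ d (fineP L m) c₀ W, x ≠ 0 → 0 < RCLike.re ⟪x, A₀ x⟫_ℂ)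
  -- the block families on bonds and on sites, given pointwise, self-adjoint
  (PB : TSite d m → BondL2K ℂ d (fineP L m) c₀ W →L[ℂ] BondL2K ℂ d (fineP L m) c₀ W)
  (hPB : ∀ (y : TSite d m) (f : BondL2K ℂ d (fineP L m) c₀ W) (b : Bond d (fineP L m)),
    WL2.equiv ℂ (fun _ : Bond d (fineP L m) => c₀) W (PB y f) b =
      if blockCoord L m (bpos b) = y then WL2.equiv ℂ (fun _ : Bond d (fineP L m) => c₀) W f b else 0)
  (hPBadj : ∀ y, ContinuousLinearMap.adjoint (PB y) = PB y)
  (PS : TSite d m → SiteL2K ℂ d (fineP L m) c₀ W →L[ℂ] SiteL2K ℂ d (fineP L m) c₀ W)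
  (hPS : ∀ (y : TSite d m) (g : SiteL2K ℂ d (fineP L m) c₀ W) (x : TSite d (fineP L m)),
    WL2.equiv ℂ (fun _ : TSite d (fineP L m) => c₀) W (PS y g) x =
      if blockCoord L m x = y then WL2.equiv ℂ (fun _ : TSite d (fineP L m) => c₀) W g x else 0)
  (hPSadj : ∀ y, ContinuousLinearMap.adjoint (PS y) = PS y)

include hm hRS hH hA₀ hPB hPBadj hPS hPSadj in
/-- **THE TRANSPOSED ROW**: if `D*_U A₀⁻¹` has the (L) letter (`0 ≤ B`) `‖(D*_U A₀⁻¹ f)(y)‖ ≤ B·e^{−κ·d_m(B(y), v)}·F` for every `f` supported over the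
bonds of `B(v)` with `‖f(b)‖ ≤ F`, then for every `g` supported over the sites of `B(u)` with `‖g(x)‖ ≤ G` and every bond `b`:
`‖(A₀⁻¹ D_U g)(b)‖ ≤ B·L^d·e^{−κ·d_m(B(b₋), u)}·G` — ne9-leaf-03's `B9Eq347LocalLetterAdjoint.local_adjoint` on `T := D*_U∘A₀⁻¹ : L²(bonds) →L L²(sites)`
(source weight `c₀`, target block mass `c₀·L^d`), read through §2's `T† = A₀⁻¹∘D_U`. [folklore]
[cite: Balaban1985BackgroundPropagators, Thm 3.1 (3.42) p.397, (3.49) p.399, (3.8) p.392, p.391, p.398 «B₀ depends on d and L»] -/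
theorem transposed_blockLetter {B κ : ℝ} (hB : 0 ≤ B)
    (hloc : ∀ (v : TSite d m) (f : BondL2K ℂ d (fineP L m) c₀ W) (F' : ℝ),
      (∀ b, blockCoord L m (bpos b) ≠ v → WL2.equiv ℂ (fun _ : Bond d (fineP L m) => c₀) W f b = 0) →
      (∀ b, ‖WL2.equiv ℂ (fun _ : Bond d (fineP L m) => c₀) W f b‖ ≤ F') →
      ∀ y : TSite d (fineP L m), ‖WL2.equiv ℂ (fun _ : TSite d (fineP L m) => c₀) W
        (covDivL2K ℂ c₀ ((η : ℂ))⁻¹ (adTransportW φ fun b => (U b)⁻¹) (greenK A₀ hpos₀ f)) y‖ ≤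
          B * Real.exp (-(κ * tdist m (blockCoord L m y) v)) * F')
    (u : TSite d m) (g : SiteL2K ℂ d (fineP L m) c₀ W) (G : ℝ)
    (hgu : ∀ x, blockCoord L m x ≠ u → WL2.equiv ℂ (fun _ : TSite d (fineP L m) => c₀) W g x = 0)
    (hgG : ∀ x, ‖WL2.equiv ℂ (fun _ : TSite d (fineP L m) => c₀) W g x‖ ≤ G) (b : Bond d (fineP L m)) :
    ‖WL2.equiv ℂ (fun _ : Bond d (fineP L m) => c₀) W (greenK A₀ hpos₀ (covDerivL2K ℂ c₀ ((η : ℂ))⁻¹ (adTransportW φ U) g)) b‖ ≤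
      B * (L : ℝ) ^ d * Real.exp (-(κ * tdist m (blockCoord L m (bpos b)) u)) * G := by
  classical
  have hc₀ : 0 < c₀ := Fact.out
  haveI : Nonempty (Bond d (fineP L m)) := ⟨b⟩
  haveI : Nonempty (TSite d (fineP L m)) := ⟨bpos b⟩
  set T : BondL2K ℂ d (fineP L m) c₀ W →L[ℂ] SiteL2K ℂ d (fineP L m) c₀ W :=
    LinearMap.toContinuousLinearMap (covDivL2K ℂ c₀ ((η : ℂ))⁻¹ (adTransportW φ fun b => (U b)⁻¹) ∘ₗ greenK A₀ hpos₀) with hTdef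
  -- the adjoint of `T` is `A₀⁻¹∘D_U`
  have hT : (ContinuousLinearMap.adjoint T) g = greenK A₀ hpos₀ (covDerivL2K ℂ c₀ ((η : ℂ))⁻¹ (adTransportW φ U) g) := by
    have h := adjoint_covDivL2K_comp_greenK φ τ η U hRS hH Q a A₀ hA₀ hpos₀
    rw [LinearMap.adjoint_eq_toCLM_adjoint] at h
    have h' := LinearMap.congr_fun h g
    simpa only [LinearMap.comp_apply, ContinuousLinearMap.coe_coe] using h'
  -- the site-block mass
  have hμ : ∀ a' : TSite d m, ∑ x : TSite d (fineP L m), (if blockCoord L m x = a' then c₀ else 0) ≤ c₀ * (L : ℝ) ^ d := fun a' => by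
    rw [← Finset.sum_filter, Finset.sum_const, nsmul_eq_mul, mul_comm]
    exact mul_le_mul_of_nonneg_left (by exact_mod_cast card_sites_block_le (L := L) (m := m) a') hc₀.le
  have hloc' : ∀ (v : TSite d m) (f : BondL2K ℂ d (fineP L m) c₀ W) (F' : ℝ),
      (∀ b, (fun b : Bond d (fineP L m) => blockCoord L m (bpos b)) b ≠ v → WL2.equiv ℂ (fun _ : Bond d (fineP L m) => c₀) W f b = 0) →
      (∀ b, ‖WL2.equiv ℂ (fun _ : Bond d (fineP L m) => c₀) W f b‖ ≤ F') →
      ∀ x, ‖WL2.equiv ℂ (fun _ : TSite d (fineP L m) => c₀) W (T f) x‖ ≤ B * Real.exp (-(κ * tdist m (blockCoord L m x) v)) * F' :=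
    fun v f F' hfv hfF x => by
      simpa only [hTdef, LinearMap.coe_toContinuousLinearMap', LinearMap.comp_apply] using hloc v f F' hfv hfF x
  have h := local_adjoint (π := fun b : Bond d (fineP L m) => blockCoord L m (bpos b)) (π' := blockCoord L m) hPB hPS T (tdist m)
    (fun a' b' => tdist_symm hm a' b') hPBadj hPSadj hB hc₀ (fun _ => le_rfl) hμ hloc' u g G hgu hgG b
  rw [hT] at h
  calc _ ≤ B * Real.sqrt (c₀ * (L : ℝ) ^ d) / Real.sqrt c₀ * Real.sqrt (c₀ * (L : ℝ) ^ d) / Real.sqrt c₀ *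
        Real.exp (-(κ * tdist m (blockCoord L m (bpos b)) u)) * G := h
    _ = B * (L : ℝ) ^ d * Real.exp (-(κ * tdist m (blockCoord L m (bpos b)) u)) * G := by
        have hs : Real.sqrt (c₀ * (L : ℝ) ^ d) / Real.sqrt c₀ = Real.sqrt ((L : ℝ) ^ d) := by
          rw [Real.sqrt_mul hc₀.le, mul_div_right_comm, div_self (Real.sqrt_pos.2 hc₀).ne', one_mul]
        have hLd : 0 ≤ (L : ℝ) ^ d := by positivity
        have key : B * Real.sqrt (c₀ * (L : ℝ) ^ d) / Real.sqrt c₀ * Real.sqrt (c₀ * (L : ℝ) ^ d) / Real.sqrt c₀ = B * (L : ℝ) ^ d := by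
          calc B * Real.sqrt (c₀ * (L : ℝ) ^ d) / Real.sqrt c₀ * Real.sqrt (c₀ * (L : ℝ) ^ d) / Real.sqrt c₀
              = B * ((Real.sqrt (c₀ * (L : ℝ) ^ d) / Real.sqrt c₀) * (Real.sqrt (c₀ * (L : ℝ) ^ d) / Real.sqrt c₀)) := by ring
            _ = B * (L : ℝ) ^ d := by rw [hs, Real.mul_self_sqrt hLd]
        rw [key]

end Transposed

end Literature.MathematicalPhysics.QuantumFieldTheory.Balaban1983to89.B9Eq326LocalPartGradientRowAdjoint

end
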